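import Literature.AlgebraicGeometry.HodgeTheory.GriffithsHolomorphicHodgeSubbundlesQPHolds
import Literature.AlgebraicGeometry.HodgeTheory.QbarFamilyLocalSystem
import Literature.AlgebraicGeometry.Motives.HodgeStructureProofs
import Mathlib.Analysis.Normed.Module.FiniteDimension
import Mathlib.Topology.LocallyConstant.Basic
import Mathlib.Topology.Subpath
import HarnessLib

/-!
# Hodge numbers of the pieces of a flat splitting are locally constant (Voisin I Prop. 9.20 pattern
# over Griffiths' holomorphy of the Hodge bundles; Deligne 1987 §1.13 «sous-variation … facteur direct»)

Family `hodge`, layer `Literature/AlgebraicGeometry/HodgeTheory`; THEOREMS ONLY (no definition, no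
named fact). Requested 2026-08-29 by the planner of route `HodgeConjecture/Q8SymplecticPowers` (memo
`ROUTE-P3v28-g37.md` §7 (C44) «FS-LEMMA»): for a polarised variation over a CONNECTED base and a flat
splitting `M = K ⊕ K'` into sub-variations, `t ↦ dim(K_t ∩ F²)` and `t ↦ dim(K'_t ∩ F²)` are upper
semicontinuous with constant sum, hence constant; at `a = dim F² = 1` one of them is identically `1`,
so `F²` sits inside a proper flat sub-bundle — the contrapositive turns a «flat span of `F²` is
everything» certificate at ONE member into irreducibility for every finite-index monodromy subgroup.

What is proved here, in the RATIONAL-TRANSPORT currency of the tree's (proved) Griffiths theorem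
`griffiths1968_holomorphicHodgeSubbundlesQP_holds` (`GriffithsHolomorphicHodgeSubbundlesQP*.lean`:
for `f : 𝒳 → S` smooth projective with `𝒳`, `S` quasi-projective, near every point `t₁` of `S(ℂ)` a
path-connected open `W` and frames `t ↦ w_i(t) ∈ ℂ ⊗ Hᵏ(X_s; ℚ)`, weakly holomorphic on a chart,
spanning the Hodge filtration `F^p` of `X_t` read at the base point `s` through rational transport
along paths inside `W`):

* §1 Linear algebra / topology (the mechanism of Voisin I Prop. 9.20): for a finite family
  `u_x = (u_x(i))_i` of vectors of a finite-dimensional `ℂ`-space depending WEAKLY CONTINUOUSLY on a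
  parameter `x` (every linear functional of every `u_x(i)` is continuous in `x`),
  `eventually_finrank_span_le` (the rank can only go up near `x₀` — lower semicontinuity, via
  Mathlib's `isOpen_setOf_linearIndependent` in coordinates), `eventually_finrank_inf_span_le` (for
  linearly independent `u_x`, `dim(K ∩ span u_x)` can only go DOWN near `x₀` — upper semicontinuity,
  via `dim(K ∩ U) + dim(K + U) = dim K + dim U`), `isLocallyConstant_of_eventually_le_of_sum_eq`
  (finitely many such functions with constant sum are locally constant),
  `finrank_finsetSup_eq_sum_of_iSupIndep` and `sum_finrank_inf_eq_finrank_of_eq_iSup` (for an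
  independent family `K_j` with `F = ⊕_j (K_j ∩ F)`: `∑_j dim(K_j ∩ F) = dim F` — the additivity
  hypothesis below, from compatibility of the splitting with `F`).
* §2 `flatSplitting_finrank_inf_F_eq_local` — **LOCAL CONSTANCY**: in the setting of the Griffiths
  theorem, every `t₁` has arbitrarily small path-connected open neighbourhoods `W` such that for every
  admissible state `T₁` at `t₁` (a rational transport from `s`), every `p`, and every finite family of
  `ℂ`-subspaces `K_j ⊆ ℂ ⊗ Hᵏ(X_s; ℚ)` whose intersections with the transported `F^p` ADD UP to
  `dim F^p` along all continuations inside `W` (the trace of «the `K_j` form a flat splitting by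
  sub-variations»: `F^p = ⊕_j (K_j ∩ F^p)`), each `dim(K_j ∩ F^p(t, T))` is the SAME for all
  continuations `(t, ε, T)` inside `W` as at `(t₁, T₁)`;
  `flatSplitting_exists_F_le_of_finrank_eq_one_local` — the case `dim F^p = 1`: one piece `K_{j₀}`
  contains the transported `F^p` at every continuation inside `W` (the shape (C44) uses: its negation
  at one member — «no single proper flat piece contains all nearby transported `F^p`» — forbids the
  splitting).

* §3 (appended) the additivity hypothesis from Hodge-compatibility, for an abstract Hodge structure
  `H` on `V` (applied by consumers to `(HS_t).comapEquiv T`): `HodgeStructure.piece_eq_iSup_inf_of_splitting`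
  (a splitting `⊕_j K_j = V_ℂ` by subspaces each of which is the sum of its intersections with the
  Hodge pieces splits every piece), `HodgeStructure.F_eq_iSup_inf_of_splitting` (… and every `F^{p₀}`),
  `HodgeStructure.sum_finrank_inf_F_eq_of_splitting` (`∑_j dim(K_j ∩ F^{p₀}) = dim F^{p₀}`), over the
  tree's proved `F_eq_iSup_piece_holds` / `iSupIndep_piece_holds`.

* §4 (appended) `flatSplitting_finrank_inf_F_eq_subpath`, `flatSplitting_finrank_inf_F_eq_of_ratTransport`,
  `flatSplitting_finrank_inf_F_eq_of_ratTransport₂` — **GLOBAL CONSTANCY along paths**: if the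
  additivity hypothesis holds at EVERY admissible state `(t, T)` (every `t ∈ S(ℂ)`, every rational
  transport `T` from `s` along a path class), then `dim(K_j ∩ F^p(t, T))` is the same at every
  admissible state as at the base state `(s, id)` — the local theorem chained along a representative
  path (`Path.subpath`, `Path.Homotopy.subpathTransSubpath`, local constancy on `unitInterval`).
  No connectedness hypothesis is needed: the statement concerns the states reachable from `s` by a
  path (all of `S(ℂ)` when it is path-connected). Consumers working at ONE member (the cell's
  germ-level criterion) need only the local form §2; the global form serves «the Hodge numbers of
  the pieces of a flat splitting (e.g. the eigenspaces of a flat automorphism) are the same at all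
  members» (route `Q8SymplecticPowers`, stub S4, clauses (o)(o′) at every member);
  `exists_ratTransport_of_irreducibleSpace` + `flatSplitting_finrank_inf_F_eq_forall_of_irreducibleSpace`:
  over an IRREDUCIBLE base every `t ∈ S(ℂ)` carries an admissible state (SGA1 XII 2.4 +
  manifold charts ⇒ `S(ℂ)` path connected), so the constancy holds at every member.

## References
* [VoisinHodgeI2002] C. Voisin, Hodge Theory and Complex Algebraic Geometry I, CUP 2002: §9.3.1
  Prop. 9.20 (Hodge numbers are constant in families: semicontinuity + constant sum), §10.2.1
  Thm. 10.3 (the `F^p` are holomorphic subbundles).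
* [Deligne1987] P. Deligne, Un théorème de finitude pour la monodromie, Progr. Math. 67 (1987),
  §1.11–1.13 (sub-variations, «facteur direct»).
* [Griffiths1968PeriodsII] P. Griffiths, Periods of integrals on algebraic manifolds II, Amer. J.
  Math. 90 (1968), Thm. 1.1.
-/

noncomputable section

open CategoryTheory AlgebraicGeometry
open _root_.Topology _root_.Filter Set Module Submodule
open scoped TensorProduct
open Literature.AlgebraicTopology.SingularHomology
open Literature.AlgebraicGeometry.Motives

namespace Literature.AlgebraicGeometry.HodgeTheory

section HodgeTheory

/-! ### §1 Semicontinuity of ranks and of intersection dimensions; constant sums -/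

section LinearAlgebra

variable {E : Type*} [AddCommGroup E] [Module ℂ E] [FiniteDimensional ℂ E]
  {X : Type*} [TopologicalSpace X] {ι : Type*} [Fintype ι]

/-- **The rank of a weakly continuous finite family of vectors can only go up nearby** (lower
semicontinuity of `x ↦ dim span{u_x(i)}`: a maximal linearly independent subfamily at `x₀` stays
independent near `x₀` — Mathlib's `isOpen_setOf_linearIndependent`, read in coordinates).
[cite: VoisinHodgeI2002, §9.3.1 Prop. 9.20] -/
theorem eventually_finrank_span_le (u : X → ι → E)
    (hu : ∀ (φ : Module.Dual ℂ E) (i : ι), Continuous fun x ↦ φ (u x i)) (x₀ : X) :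
    ∀ᶠ x in 𝓝 x₀, finrank ℂ ↥(span ℂ (range (u x₀))) ≤ finrank ℂ ↥(span ℂ (range (u x))) := by
  classical
  set b := Module.finBasis ℂ E with hb
  set e : E ≃ₗ[ℂ] (Fin (finrank ℂ E) → ℂ) := b.equivFun with he
  -- a linearly independent subfamily at `x₀` with the same span
  obtain ⟨κ, a, ha, hspan, hli⟩ := exists_linearIndependent' ℂ (u x₀)
  haveI : Finite κ := Finite.of_injective a ha
  letI : Fintype κ := Fintype.ofFinite κ
  -- in coordinates the subfamily varies continuously, so it stays independent near `x₀`
  have hcont : Continuous fun x ↦ fun j : κ ↦ e (u x (a j)) := by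
    refine continuous_pi fun j ↦ continuous_pi fun l ↦ ?_
    have : (fun x ↦ e (u x (a j)) l) = fun x ↦ b.coord l (u x (a j)) := by
      funext x
      rw [he, Basis.equivFun_apply, Basis.coord_apply]
    rw [this]
    exact hu (b.coord l) (a j)
  have hopen : IsOpen {g : κ → (Fin (finrank ℂ E) → ℂ) | LinearIndependent ℂ g} :=
    isOpen_setOf_linearIndependent
  have hx₀ : LinearIndependent ℂ (fun j : κ ↦ e (u x₀ (a j))) :=
    hli.map' e.toLinearMap e.ker
  have hev : ∀ᶠ x in 𝓝 x₀, LinearIndependent ℂ (fun j : κ ↦ e (u x (a j))) :=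
    hcont.continuousAt.eventually (hopen.mem_nhds hx₀)
  filter_upwards [hev] with x hx
  have hx' : LinearIndependent ℂ (u x ∘ a) :=
    LinearIndependent.of_comp e.toLinearMap (by simpa [Function.comp_def] using hx)
  calc finrank ℂ ↥(span ℂ (range (u x₀)))
      = finrank ℂ ↥(span ℂ (range (u x₀ ∘ a))) := by rw [hspan]
    _ = Fintype.card κ := finrank_span_eq_card hli
    _ = finrank ℂ ↥(span ℂ (range (u x ∘ a))) := (finrank_span_eq_card hx').symm
    _ ≤ finrank ℂ ↥(span ℂ (range (u x))) :=
        Submodule.finrank_mono (span_mono (range_comp_subset_range a (u x)))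

/-- **For a linearly independent weakly continuous family, `dim(K ∩ span u_x)` can only go down
nearby** (upper semicontinuity): `dim(K ∩ U) + dim(K + U) = dim K + dim U` with `dim U` constant and
`dim(K + U) = rank` of the family `(basis of K, u_x)`, which can only go up.
[cite: VoisinHodgeI2002, §9.3.1 Prop. 9.20] -/
theorem eventually_finrank_inf_span_le (K : Submodule ℂ E) (u : X → ι → E)
    (hu : ∀ (φ : Module.Dual ℂ E) (i : ι), Continuous fun x ↦ φ (u x i))
    (hli : ∀ x, LinearIndependent ℂ (u x)) (x₀ : X) :
    ∀ᶠ x in 𝓝 x₀,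
      finrank ℂ ↥(K ⊓ span ℂ (range (u x))) ≤ finrank ℂ ↥(K ⊓ span ℂ (range (u x₀))) := by
  classical
  -- a basis of `K`, as vectors of `E`
  set bK := Module.finBasis ℂ K with hbK
  set v : Fin (finrank ℂ K) → E := fun j ↦ (bK j : E) with hv
  have hKspan : span ℂ (range v) = K := by
    have : range v = K.subtype '' range bK := by
      rw [← range_comp]; rfl
    rw [this, ← Submodule.map_span, bK.span_eq, Submodule.map_top, Submodule.range_subtype]
  -- the concatenated family
  set U : X → (Fin (finrank ℂ K) ⊕ ι) → E := fun x ↦ Sum.elim v (u x) with hU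
  have hUcont : ∀ (φ : Module.Dual ℂ E) (i : Fin (finrank ℂ K) ⊕ ι), Continuous fun x ↦ φ (U x i) := by
    rintro φ (j | i)
    · simpa [hU] using continuous_const
    · simpa [hU] using hu φ i
  have hUspan : ∀ x, span ℂ (range (U x)) = K ⊔ span ℂ (range (u x)) := fun x ↦ by
    rw [hU, Set.Sum.elim_range, Submodule.span_union, hKspan]
  have hrank : ∀ x, finrank ℂ ↥(span ℂ (range (u x))) = Fintype.card ι :=
    fun x ↦ finrank_span_eq_card (hli x)
  have hdim : ∀ x, finrank ℂ ↥(K ⊔ span ℂ (range (u x))) + finrank ℂ ↥(K ⊓ span ℂ (range (u x))) =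
      finrank ℂ K + Fintype.card ι := fun x ↦ by
    rw [← hrank x]; exact Submodule.finrank_sup_add_finrank_inf_eq K _
  filter_upwards [eventually_finrank_span_le U hUcont x₀] with x hx
  rw [hUspan, hUspan] at hx
  have h1 := hdim x
  have h2 := hdim x₀
  omega

/-- **Finitely many ℕ-valued functions, each of which can only go down nearby, with constant sum,
are locally constant.** [cite: VoisinHodgeI2002, §9.3.1 Prop. 9.20] -/
theorem isLocallyConstant_of_eventually_le_of_sum_eq {J : Type*} [Fintype J] (g : J → X → ℕ)
    (c : ℕ) (hle : ∀ j x₀, ∀ᶠ x in 𝓝 x₀, g j x ≤ g j x₀) (hsum : ∀ x, ∑ j, g j x = c) (j : J) :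
    IsLocallyConstant (g j) := by
  classical
  rw [IsLocallyConstant.iff_eventually_eq]
  intro x₀
  have hall : ∀ᶠ x in 𝓝 x₀, ∀ j, g j x ≤ g j x₀ := eventually_all.2 fun j ↦ hle j x₀
  filter_upwards [hall] with x hx
  have hzero : ∑ i, (g i x₀ - g i x) = 0 := by
    rw [Finset.sum_tsub_distrib Finset.univ (fun i _ ↦ hx i), hsum, hsum, Nat.sub_self]
  have hi := (Finset.sum_eq_zero_iff.1 hzero) j (Finset.mem_univ j)
  exact le_antisymm (hx j) (Nat.sub_eq_zero_iff_le.1 hi)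

/-- `dim (N_{j₁} + ⋯ + N_{jₘ}) = ∑ dim N_j` for an INDEPENDENT family (finite partial sums).
[cite: VoisinHodgeI2002, §9.3.1 Prop. 9.20] -/
theorem finrank_finsetSup_eq_sum_of_iSupIndep {J : Type*} (N : J → Submodule ℂ E)
    (hind : iSupIndep N) (s : Finset J) :
    finrank ℂ ↥(s.sup N) = ∑ j ∈ s, finrank ℂ ↥(N j) := by
  classical
  induction s using Finset.induction_on with
  | empty => simp
  | insert j s hj ih =>
    rw [Finset.sup_insert, Finset.sum_insert hj, ← ih]
    have hdis : Disjoint (N j) (s.sup N) := by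
      rw [Finset.sup_eq_iSup]
      exact hind.disjoint_biSup (y := (↑s : Set J)) (by exact_mod_cast hj)
    have h := Submodule.finrank_sup_add_finrank_inf_eq (N j) (s.sup N)
    rw [hdis.eq_bot, finrank_bot, add_zero] at h
    exact h

/-- **Additivity of `dim(K_j ∩ F)` for a splitting compatible with `F`**: if the `K_j` are
independent and `F = ⊕_j (K_j ∩ F)` (e.g. the `K_j` are the pieces of a splitting of a Hodge
structure by Hodge subspaces and `F` is a step of the Hodge filtration), then
`∑_j dim(K_j ∩ F) = dim F` — the hypothesis `hadd` of `flatSplitting_finrank_inf_F_eq_local`.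
[cite: VoisinHodgeI2002, §9.3.1 Prop. 9.20] -/
theorem sum_finrank_inf_eq_finrank_of_eq_iSup {J : Type*} [Fintype J] (K : J → Submodule ℂ E)
    (hind : iSupIndep K) (F : Submodule ℂ E) (hF : F = ⨆ j, K j ⊓ F) :
    ∑ j, finrank ℂ ↥(K j ⊓ F) = finrank ℂ ↥F := by
  classical
  have hind' : iSupIndep fun j ↦ K j ⊓ F := hind.mono fun j ↦ inf_le_left
  have hsup : Finset.univ.sup (fun j ↦ K j ⊓ F) = F := by
    rw [Finset.sup_eq_iSup]
    simp only [Finset.mem_univ, iSup_pos]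
    exact hF.symm
  conv_rhs => rw [← hsup]
  exact (finrank_finsetSup_eq_sum_of_iSupIndep _ hind' Finset.univ).symm

end LinearAlgebra

/-! ### §2 Local constancy of `dim(K_j ∩ F^p)` for a flat splitting, over Griffiths' theorem -/

section Family

/-- **LOCAL CONSTANCY of the Hodge numbers of the pieces of a flat splitting** (Voisin I Prop. 9.20
pattern over Griffiths' holomorphy of `F^p`, tree theorem `griffiths1968_holomorphicHodgeSubbundlesQP_holds`).
Setting: `f : 𝒳 → S` smooth projective of relative dimension `n`, `𝒳` and `S` quasi-projective,
`S` smooth of dimension `d`, `Rᵏ f_* ℂ` locally trivial (`hU`), Hodge models `A t` with Hodge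
symmetry, base point `s`. CONCLUSION: every `t₁ ∈ S(ℂ)` has arbitrarily small path-connected open
neighbourhoods `W` such that: for every rational transport `T₁ : Hᵏ(X_s;ℚ) ≃ Hᵏ(X_{t₁};ℚ)` along a
path class from `s`, every `p`, and every finite family `K_j ⊆ ℂ ⊗ Hᵏ(X_s; ℚ)` with
`∑_j dim(K_j ∩ F^p(t,T)) = dim F^p(t,T)` at every continuation `(t, ε, T)` of `T₁` inside `W`
(`F^p(t,T)` = the Hodge filtration of `X_t` pulled back to `s` by `T`:
`((A t).hodgeStructure …).comapEquiv T).F p`) — e.g. a flat splitting `⊕_j K_j` of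
`ℂ ⊗ Hᵏ(X_s;ℚ)` by subspaces compatible with the Hodge decomposition at every `t` — one has
`dim(K_j ∩ F^p(t,T)) = dim(K_j ∩ F^p(t₁,T₁))` for every `j` and every continuation `(t, ε, T)`
inside `W`. [cite: VoisinHodgeI2002, §9.3.1 Prop. 9.20 and §10.2.1 Thm. 10.3]
[cite: Deligne1987, §1.13 (p. 10–11)] -/
theorem flatSplitting_finrank_inf_F_eq_local {𝒳 S : SchemeOver ℂ} (f : 𝒳 ⟶ S) (n k d : ℕ)
    (hf : IsSmoothProjectiveFamily f n) (hS : IsQuasiProjectiveOver S) (h𝒳 : IsQuasiProjectiveOver 𝒳)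
    [AlgebraicGeometry.SmoothOfRelativeDimension d S.hom]
    (hU : IsCohomologicallyLocallyTrivialOn f (Set.univ : Set (ComplexPoints S)))
    (A : ∀ t : ComplexPoints S, HodgeModel n (fiberOver f t)) (hA : ∀ t, (A t).IsHodgeSymmetric)
    [∀ t, Module.Finite ℚ (singularCohomology ℚ ℚ (ComplexPoints (fiberOver f t)) k)]
    (s t₁ : (Set.univ : Set (ComplexPoints S))) (N : Set (Set.univ : Set (ComplexPoints S)))
    (hN : N ∈ 𝓝 t₁) :
    ∃ W : Set (Set.univ : Set (ComplexPoints S)), IsOpen W ∧ t₁ ∈ W ∧ W ⊆ N ∧ IsPathConnected W ∧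
    ∀ (T₁ : singularCohomology ℚ ℚ (ComplexPoints (fiberOver f s.1)) k ≃ₗ[ℚ]
        singularCohomology ℚ ℚ (ComplexPoints (fiberOver f t₁.1)) k),
      (∃ δ₁ : Path.Homotopic.Quotient s t₁,
        ∀ v, ofRatClass _ k (T₁ v) = transportFun f k hU δ₁ (ofRatClass _ k v)) →
      ∀ (p : ℤ) {J : Type} [Fintype J]
        (K : J → Submodule ℂ (ℂ ⊗[ℚ] singularCohomology ℚ ℚ (ComplexPoints (fiberOver f s.1)) k)),
        (∀ t ∈ W, ∀ (ε : Path t₁ t), (∀ r', ε r' ∈ W) →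
          ∀ (T : singularCohomology ℚ ℚ (ComplexPoints (fiberOver f s.1)) k ≃ₗ[ℚ]
            singularCohomology ℚ ℚ (ComplexPoints (fiberOver f t.1)) k),
          (∀ v, ofRatClass _ k (T v) = transportFun f k hU ⟦ε⟧ (ofRatClass _ k (T₁ v))) →
          ∑ j, finrank ℂ ↥(K j ⊓
              (((A t.1).hodgeStructure (hf.isSmoothProjective t.1) (hA t.1) k).comapEquiv T).F p) =
            finrank ℂ ↥((((A t.1).hodgeStructure (hf.isSmoothProjective t.1) (hA t.1) k).comapEquiv T).F p)) →
        ∀ (j : J), ∀ t ∈ W, ∀ (ε : Path t₁ t), (∀ r', ε r' ∈ W) →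
          ∀ (T : singularCohomology ℚ ℚ (ComplexPoints (fiberOver f s.1)) k ≃ₗ[ℚ]
            singularCohomology ℚ ℚ (ComplexPoints (fiberOver f t.1)) k),
          (∀ v, ofRatClass _ k (T v) = transportFun f k hU ⟦ε⟧ (ofRatClass _ k (T₁ v))) →
          finrank ℂ ↥(K j ⊓
              (((A t.1).hodgeStructure (hf.isSmoothProjective t.1) (hA t.1) k).comapEquiv T).F p) =
            finrank ℂ ↥(K j ⊓
              (((A t₁.1).hodgeStructure (hf.isSmoothProjective t₁.1) (hA t₁.1) k).comapEquiv T₁).F p) := by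
  classical
  obtain ⟨W, hWo, ht₁W, hWN, hWpc, ψ, hWψ, hframe⟩ :=
    griffiths1968_holomorphicHodgeSubbundlesQP_holds f n k d hf hS h𝒳 hU A hA s t₁ N hN
  refine ⟨W, hWo, ht₁W, hWN, hWpc, fun T₁ hT₁ p J _ K hadd j t ht ε hε T hT ↦ ?_⟩
  obtain ⟨r, w, hw, han⟩ := hframe T₁ hT₁ p
  -- rational classes are preserved by transport (smooth projective family), so every point of `W`
  -- is reached by an admissible continuation of `T₁`
  have hrat : ∀ (a b : (Set.univ : Set (ComplexPoints S))) (γ : Path.Homotopic.Quotient a b)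
      (α : complexBetti (fiberOver f a.1) k),
      IsRationalClass α → IsRationalClass (transportFun f k hU γ α) :=
    fun a b γ α hα ↦ isRationalClass_transportFun_of_isSmoothProjectiveFamily (f := f) (k := k) d hf hS γ hα
  have hreach : ∀ x : W, ∃ (εx : Path t₁ x.1) (_ : ∀ r', εx r' ∈ W)
      (Tx : singularCohomology ℚ ℚ (ComplexPoints (fiberOver f s.1)) k ≃ₗ[ℚ]
        singularCohomology ℚ ℚ (ComplexPoints (fiberOver f x.1.1)) k),
      ∀ v, ofRatClass _ k (Tx v) = transportFun f k hU ⟦εx⟧ (ofRatClass _ k (T₁ v)) := by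
    intro x
    have hj : JoinedIn W t₁ x.1 := hWpc.joinedIn t₁ ht₁W x.1 x.2
    obtain ⟨R, hR⟩ := exists_ratTransport f k hU hrat (⟦hj.somePath⟧ : Path.Homotopic.Quotient t₁ x.1)
    exact ⟨hj.somePath, hj.somePath_mem, T₁.trans R, fun v ↦ by
      rw [LinearEquiv.trans_apply, hR]⟩
  choose εx hεx Tx hTx using hreach
  -- the dimension functions on `W`
  set g : J → W → ℕ := fun j x ↦ finrank ℂ ↥(K j ⊓ span ℂ (range fun i ↦ w i x.1)) with hg
  -- weak continuity of the frames on `W`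
  have hcont : ∀ (φ : Module.Dual ℂ (ℂ ⊗[ℚ] singularCohomology ℚ ℚ (ComplexPoints (fiberOver f s.1)) k))
      (i : Fin r), Continuous fun x : W ↦ φ (w i x.1) := by
    intro φ i
    have h1 : ContinuousOn (fun z ↦ φ (w i (ψ.symm z))) (ψ '' W) := (han i φ).continuousOn
    have h2 : ContinuousOn ψ W := ψ.continuousOn.mono hWψ
    have h3 : ContinuousOn (fun t ↦ φ (w i (ψ.symm (ψ t)))) W :=
      h1.comp h2 (fun t ht ↦ mem_image_of_mem ψ ht)
    have h4 : ContinuousOn (fun t ↦ φ (w i t)) W := by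
      refine h3.congr fun t ht ↦ ?_
      simp only [ψ.left_inv (hWψ ht)]
    rw [continuousOn_iff_continuous_restrict] at h4
    exact h4
  have hli : ∀ x : W, LinearIndependent ℂ (fun i ↦ w i x.1) :=
    fun x ↦ (hw x.1 x.2 (εx x) (hεx x) (Tx x) (hTx x)).1
  have hle : ∀ j' (x₀ : W), ∀ᶠ x in 𝓝 x₀, g j' x ≤ g j' x₀ :=
    fun j' x₀ ↦ eventually_finrank_inf_span_le (K j') (fun (x : W) i ↦ w i x.1) hcont hli x₀
  have hsum : ∀ x : W, ∑ j', g j' x = r := by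
    intro x
    have hF := (hw x.1 x.2 (εx x) (hεx x) (Tx x) (hTx x)).2
    have := hadd x.1 x.2 (εx x) (hεx x) (Tx x) (hTx x)
    rw [hF, finrank_span_eq_card (hli x), Fintype.card_fin] at this
    exact this
  have hlc : IsLocallyConstant (g j) := isLocallyConstant_of_eventually_le_of_sum_eq g r hle hsum j
  haveI : PreconnectedSpace W := Subtype.preconnectedSpace hWpc.isConnected.isPreconnected
  have hconst : g j ⟨t, ht⟩ = g j ⟨t₁, ht₁W⟩ := hlc.apply_eq_of_preconnectedSpace _ _
  -- read the two sides through the frames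
  have hFt := (hw t ht ε hε T hT).2
  have hrefl : ∀ r', (Path.refl t₁) r' ∈ W := fun _ ↦ ht₁W
  have hT₁' : ∀ v, ofRatClass _ k (T₁ v) =
      transportFun f k hU ⟦Path.refl t₁⟧ (ofRatClass _ k (T₁ v)) := fun v ↦ by
    change _ = transportFun f k hU (Path.Homotopic.Quotient.refl t₁) _
    rw [transportFun_refl]
  have hFt₁ := (hw t₁ ht₁W (Path.refl t₁) hrefl T₁ hT₁').2
  rw [hFt, hFt₁]
  exact hconst

/-- **The case `dim F^p = 1`** (the cell's (C44) at `e = 4`, `a = 1`): with `W` as in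
`flatSplitting_finrank_inf_F_eq_local`, if `dim F^p(t₁,T₁) = 1` then ONE piece `K_{j₀}` contains
the transported `F^p(t,T)` at EVERY continuation `(t, ε, T)` of `T₁` inside `W`. Contrapositive
(the consumer's shape): if near `t₁` the transported lines `F^p(t,T)` are not all contained in any
single proper piece, no such splitting exists. [cite: VoisinHodgeI2002, §9.3.1 Prop. 9.20 and §10.2.1 Thm. 10.3]
[cite: Deligne1987, §1.13 (p. 10–11)] -/
theorem flatSplitting_exists_F_le_of_finrank_eq_one_local {𝒳 S : SchemeOver ℂ} (f : 𝒳 ⟶ S)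
    (n k d : ℕ)
    (hf : IsSmoothProjectiveFamily f n) (hS : IsQuasiProjectiveOver S) (h𝒳 : IsQuasiProjectiveOver 𝒳)
    [AlgebraicGeometry.SmoothOfRelativeDimension d S.hom]
    (hU : IsCohomologicallyLocallyTrivialOn f (Set.univ : Set (ComplexPoints S)))
    (A : ∀ t : ComplexPoints S, HodgeModel n (fiberOver f t)) (hA : ∀ t, (A t).IsHodgeSymmetric)
    [∀ t, Module.Finite ℚ (singularCohomology ℚ ℚ (ComplexPoints (fiberOver f t)) k)]
    (s t₁ : (Set.univ : Set (ComplexPoints S))) (N : Set (Set.univ : Set (ComplexPoints S)))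
    (hN : N ∈ 𝓝 t₁) :
    ∃ W : Set (Set.univ : Set (ComplexPoints S)), IsOpen W ∧ t₁ ∈ W ∧ W ⊆ N ∧ IsPathConnected W ∧
    ∀ (T₁ : singularCohomology ℚ ℚ (ComplexPoints (fiberOver f s.1)) k ≃ₗ[ℚ]
        singularCohomology ℚ ℚ (ComplexPoints (fiberOver f t₁.1)) k),
      (∃ δ₁ : Path.Homotopic.Quotient s t₁,
        ∀ v, ofRatClass _ k (T₁ v) = transportFun f k hU δ₁ (ofRatClass _ k v)) →
      ∀ (p : ℤ) {J : Type} [Fintype J]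
        (K : J → Submodule ℂ (ℂ ⊗[ℚ] singularCohomology ℚ ℚ (ComplexPoints (fiberOver f s.1)) k)),
        (∀ t ∈ W, ∀ (ε : Path t₁ t), (∀ r', ε r' ∈ W) →
          ∀ (T : singularCohomology ℚ ℚ (ComplexPoints (fiberOver f s.1)) k ≃ₗ[ℚ]
            singularCohomology ℚ ℚ (ComplexPoints (fiberOver f t.1)) k),
          (∀ v, ofRatClass _ k (T v) = transportFun f k hU ⟦ε⟧ (ofRatClass _ k (T₁ v))) →
          ∑ j, finrank ℂ ↥(K j ⊓
              (((A t.1).hodgeStructure (hf.isSmoothProjective t.1) (hA t.1) k).comapEquiv T).F p) =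
            finrank ℂ ↥((((A t.1).hodgeStructure (hf.isSmoothProjective t.1) (hA t.1) k).comapEquiv T).F p)) →
        finrank ℂ ↥((((A t₁.1).hodgeStructure (hf.isSmoothProjective t₁.1) (hA t₁.1) k).comapEquiv T₁).F p) = 1 →
        ∃ j₀ : J, ∀ t ∈ W, ∀ (ε : Path t₁ t), (∀ r', ε r' ∈ W) →
          ∀ (T : singularCohomology ℚ ℚ (ComplexPoints (fiberOver f s.1)) k ≃ₗ[ℚ]
            singularCohomology ℚ ℚ (ComplexPoints (fiberOver f t.1)) k),
          (∀ v, ofRatClass _ k (T v) = transportFun f k hU ⟦ε⟧ (ofRatClass _ k (T₁ v))) →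
          (((A t.1).hodgeStructure (hf.isSmoothProjective t.1) (hA t.1) k).comapEquiv T).F p ≤ K j₀ := by
  classical
  obtain ⟨W, hWo, ht₁W, hWN, hWpc, hW⟩ :=
    flatSplitting_finrank_inf_F_eq_local f n k d hf hS h𝒳 hU A hA s t₁ N hN
  refine ⟨W, hWo, ht₁W, hWN, hWpc, fun T₁ hT₁ p J _ K hadd hone ↦ ?_⟩
  -- at `t₁`: the dimensions add up to `1`, so one of them is `1`
  have hrefl : ∀ r', (Path.refl t₁) r' ∈ W := fun _ ↦ ht₁W
  have hT₁' : ∀ v, ofRatClass _ k (T₁ v) =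
      transportFun f k hU ⟦Path.refl t₁⟧ (ofRatClass _ k (T₁ v)) := fun v ↦ by
    change _ = transportFun f k hU (Path.Homotopic.Quotient.refl t₁) _
    rw [transportFun_refl]
  have hsum₁ := hadd t₁ ht₁W (Path.refl t₁) hrefl T₁ hT₁'
  rw [hone] at hsum₁
  obtain ⟨j₀, -, hj₀⟩ : ∃ j₀ ∈ Finset.univ, finrank ℂ ↥(K j₀ ⊓
      (((A t₁.1).hodgeStructure (hf.isSmoothProjective t₁.1) (hA t₁.1) k).comapEquiv T₁).F p) = 1 := by
    by_contra hne
    push Not at hne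
    -- every term is `0` (a term `≥ 2` or all `0` contradicts the sum `1`)
    have hle : ∀ j ∈ Finset.univ, finrank ℂ ↥(K j ⊓
        (((A t₁.1).hodgeStructure (hf.isSmoothProjective t₁.1) (hA t₁.1) k).comapEquiv T₁).F p) ≤ 1 :=
      fun j _ ↦ by
        calc _ ≤ finrank ℂ ↥((((A t₁.1).hodgeStructure (hf.isSmoothProjective t₁.1) (hA t₁.1) k).comapEquiv T₁).F p) :=
              Submodule.finrank_mono inf_le_right
          _ = 1 := hone
    have hlt : ∀ j ∈ Finset.univ, finrank ℂ ↥(K j ⊓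
        (((A t₁.1).hodgeStructure (hf.isSmoothProjective t₁.1) (hA t₁.1) k).comapEquiv T₁).F p) = 0 :=
      fun j hj ↦ by have := hle j hj; have := hne j hj; omega
    rw [Finset.sum_eq_zero hlt] at hsum₁
    exact zero_ne_one hsum₁
  refine ⟨j₀, fun t ht ε hε T hT ↦ ?_⟩
  have hconst := hW T₁ hT₁ p K hadd j₀ t ht ε hε T hT
  rw [hj₀] at hconst
  -- `dim F^p(t,T) = 1` as well (the sums agree), so `K j₀ ∩ F = F`
  have hsumt := hadd t ht ε hε T hT
  have hall : ∀ j, finrank ℂ ↥(K j ⊓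
      (((A t.1).hodgeStructure (hf.isSmoothProjective t.1) (hA t.1) k).comapEquiv T).F p) =
      finrank ℂ ↥(K j ⊓
      (((A t₁.1).hodgeStructure (hf.isSmoothProjective t₁.1) (hA t₁.1) k).comapEquiv T₁).F p) :=
    fun j ↦ hW T₁ hT₁ p K hadd j t ht ε hε T hT
  have hFt : finrank ℂ ↥((((A t.1).hodgeStructure (hf.isSmoothProjective t.1) (hA t.1) k).comapEquiv T).F p) = 1 := by
    rw [← hsumt, Finset.sum_congr rfl fun j _ ↦ hall j]
    have := hadd t₁ ht₁W (Path.refl t₁) hrefl T₁ hT₁'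
    rw [this, hone]
  have heq := Submodule.eq_of_le_of_finrank_eq (inf_le_right : K j₀ ⊓
      (((A t.1).hodgeStructure (hf.isSmoothProjective t.1) (hA t.1) k).comapEquiv T).F p ≤ _)
    (by rw [hconst, hFt])
  rw [← heq]
  exact inf_le_left

end Family

/-! ### §3 The additivity hypothesis from compatibility of the splitting with the Hodge structure -/

section HodgeCompatible

variable {V : Type*} [AddCommGroup V] [Module ℚ V] {m : ℤ} (H : Motives.HodgeStructure V m)

/-- **A splitting of `V_ℂ` by Hodge subspaces splits every Hodge piece**: if `⊕_j K_j = V_ℂ` (as a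
supremum) and every `K_j` is the sum of its intersections with the Hodge pieces `V^{p,m-p}`, then
`V^{i,m-i} = ⊕_j (K_j ∩ V^{i,m-i})` (independence of the pieces, Deligne Hodge II 1.2.5, and the
modular law). [cite: VoisinHodgeI2002, §7.1.1 and §9.3.1 Prop. 9.20] -/
theorem HodgeStructure.piece_eq_iSup_inf_of_splitting {J : Type*} (K : J → Submodule ℂ (ℂ ⊗[ℚ] V))
    (htop : ⨆ j, K j = ⊤) (hK : ∀ j, K j = ⨆ p, K j ⊓ H.piece p (m - p)) (i : ℤ) :
    H.piece i (m - i) = ⨆ j, K j ⊓ H.piece i (m - i) := by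
  refine le_antisymm ?_ (iSup_le fun j ↦ inf_le_right)
  -- `N p := ⊕_j (K_j ∩ V^{p})`, `N p ≤ V^{p}`, `⊕_p N p = ⊤`
  set N : ℤ → Submodule ℂ (ℂ ⊗[ℚ] V) := fun p ↦ ⨆ j, K j ⊓ H.piece p (m - p) with hN
  have hNle : ∀ p, N p ≤ H.piece p (m - p) := fun p ↦ iSup_le fun j ↦ inf_le_right
  have hNtop : ⨆ p, N p = ⊤ := by
    rw [eq_top_iff, ← htop, iSup_le_iff]
    intro j
    rw [hK j, iSup_le_iff]
    intro p
    exact (le_iSup (fun j' ↦ K j' ⊓ H.piece p (m - p)) j).trans (le_iSup N p)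
  -- `V^{i} = V^{i} ∩ (N i + Σ_{p ≠ i} N p) = N i + V^{i} ∩ (Σ_{p ≠ i} N p) = N i`
  have hind := Motives.HodgeStructure.iSupIndep_piece_holds H
  have hdis : Disjoint (H.piece i (m - i)) (⨆ (p) (_ : p ≠ i), N p) := by
    have h1 : Disjoint (H.piece i (m - i)) (⨆ (p) (_ : p ≠ i), H.piece p (m - p)) := by
      have := hind.disjoint_biSup (y := ({i}ᶜ : Set ℤ)) (x := i) (by simp)
      simpa [Set.mem_compl_singleton_iff] using this
    exact h1.mono_right (iSup₂_mono fun p _ ↦ hNle p)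
  have hcalc : H.piece i (m - i) = N i :=
    calc H.piece i (m - i) = H.piece i (m - i) ⊓ ⨆ p, N p := by rw [hNtop, inf_top_eq]
      _ = H.piece i (m - i) ⊓ (N i ⊔ ⨆ (p) (_ : p ≠ i), N p) := by rw [iSup_split_single N i]
      _ = (N i ⊔ ⨆ (p) (_ : p ≠ i), N p) ⊓ H.piece i (m - i) := inf_comm _ _
      _ = N i ⊔ (⨆ (p) (_ : p ≠ i), N p) ⊓ H.piece i (m - i) := sup_inf_assoc_of_le _ (hNle i)
      _ = N i := by rw [inf_comm, hdis.eq_bot, sup_bot_eq]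
  exact hcalc.le

/-- **Every step `F^{p₀}` of the Hodge filtration is split by such a splitting**:
`F^{p₀} = ⊕_j (K_j ∩ F^{p₀})` (from `F^{p₀} = ⊕_{i ≥ p₀} V^{i,m-i}`, Deligne Hodge II 1.2.5, and
the previous lemma) — so `∑_j dim(K_j ∩ F^{p₀}) = dim F^{p₀}` by
`sum_finrank_inf_eq_finrank_of_eq_iSup` when the `K_j` are independent: the hypothesis `hadd` of §2
for the pieces of a flat splitting by Hodge subspaces. [cite: VoisinHodgeI2002, §7.1.1 and §9.3.1 Prop. 9.20] -/
theorem HodgeStructure.F_eq_iSup_inf_of_splitting {J : Type*} (K : J → Submodule ℂ (ℂ ⊗[ℚ] V))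
    (htop : ⨆ j, K j = ⊤) (hK : ∀ j, K j = ⨆ p, K j ⊓ H.piece p (m - p)) (p₀ : ℤ) :
    H.F p₀ = ⨆ j, K j ⊓ H.F p₀ := by
  refine le_antisymm ?_ (iSup_le fun j ↦ inf_le_right)
  rw [Motives.HodgeStructure.F_eq_iSup_piece_holds H p₀, iSup₂_le_iff]
  intro i hi
  rw [HodgeStructure.piece_eq_iSup_inf_of_splitting H K htop hK i, iSup_le_iff]
  intro j
  refine le_trans ?_ (le_iSup (fun j' ↦ K j' ⊓ ⨆ (i') (_ : p₀ ≤ i'), H.piece i' (m - i')) j)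
  exact inf_le_inf_left _ (le_iSup₂ (f := fun i' (_ : p₀ ≤ i') ↦ H.piece i' (m - i')) i hi)

/-- **`hadd` for a splitting by Hodge subspaces**: independent `K_j` with `⊕_j K_j = V_ℂ`, each the
sum of its intersections with the Hodge pieces ⇒ `∑_j dim(K_j ∩ F^{p₀}) = dim F^{p₀}`.
[cite: VoisinHodgeI2002, §7.1.1 and §9.3.1 Prop. 9.20] -/
theorem HodgeStructure.sum_finrank_inf_F_eq_of_splitting [FiniteDimensional ℚ V] {J : Type*}
    [Fintype J] (K : J → Submodule ℂ (ℂ ⊗[ℚ] V)) (hind : iSupIndep K) (htop : ⨆ j, K j = ⊤)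
    (hK : ∀ j, K j = ⨆ p, K j ⊓ H.piece p (m - p)) (p₀ : ℤ) :
    ∑ j, finrank ℂ ↥(K j ⊓ H.F p₀) = finrank ℂ ↥(H.F p₀) :=
  sum_finrank_inf_eq_finrank_of_eq_iSup K hind (H.F p₀)
    (HodgeStructure.F_eq_iSup_inf_of_splitting H K htop hK p₀)

end HodgeCompatible

/-! ### §4 Global constancy along paths (the local theorem chained over a representative path) -/

section Global

/-- **Walking along a path.** In the setting of `flatSplitting_finrank_inf_F_eq_local`, suppose
the additivity `∑_j dim(K_j ∩ F^p(t,T)) = dim F^p(t,T)` holds at EVERY admissible state (every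
`t`, every rational transport `T` from `s` along a path class). Let `γ` be a path in `S(ℂ)`, `T₀`
an admissible state at the point `γ r₀`, and `T` the state at `γ r` obtained from `T₀` by
continuation along the sub-path `γ|[r₀, r]`. Then `dim(K_j ∩ F^p(γ r, T)) = dim(K_j ∩ F^p(γ r₀, T₀))`.
(Proof: `r ↦ dim(K_j ∩ F^p(γ r, T_r))` is locally constant on `[0,1]` by the local theorem at
`γ r₁`, the sub-path `γ|[r₁, r]` staying inside the good neighbourhood `W` for `r` near `r₁`.)
The endpoints are taken as free variables `x₀ = γ r₀`, `x = γ r` so that consumers can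
instantiate them without casts. [cite: VoisinHodgeI2002, §9.3.1 Prop. 9.20 and §10.2.1 Thm. 10.3]
[cite: Deligne1987, §1.13 (p. 10–11)] -/
theorem flatSplitting_finrank_inf_F_eq_subpath {𝒳 S : SchemeOver ℂ} (f : 𝒳 ⟶ S) (n k d : ℕ)
    (hf : IsSmoothProjectiveFamily f n) (hS : IsQuasiProjectiveOver S) (h𝒳 : IsQuasiProjectiveOver 𝒳)
    [AlgebraicGeometry.SmoothOfRelativeDimension d S.hom]
    (hU : IsCohomologicallyLocallyTrivialOn f (Set.univ : Set (ComplexPoints S)))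
    (A : ∀ t : ComplexPoints S, HodgeModel n (fiberOver f t)) (hA : ∀ t, (A t).IsHodgeSymmetric)
    [∀ t, Module.Finite ℚ (singularCohomology ℚ ℚ (ComplexPoints (fiberOver f t)) k)]
    (s : (Set.univ : Set (ComplexPoints S))) (p : ℤ) {J : Type} [Fintype J]
    (K : J → Submodule ℂ (ℂ ⊗[ℚ] singularCohomology ℚ ℚ (ComplexPoints (fiberOver f s.1)) k))
    (hadd : ∀ (t : (Set.univ : Set (ComplexPoints S))) (δ : Path.Homotopic.Quotient s t)
      (T : singularCohomology ℚ ℚ (ComplexPoints (fiberOver f s.1)) k ≃ₗ[ℚ]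
        singularCohomology ℚ ℚ (ComplexPoints (fiberOver f t.1)) k),
      (∀ v, ofRatClass _ k (T v) = transportFun f k hU δ (ofRatClass _ k v)) →
      ∑ j, finrank ℂ ↥(K j ⊓
          (((A t.1).hodgeStructure (hf.isSmoothProjective t.1) (hA t.1) k).comapEquiv T).F p) =
        finrank ℂ ↥((((A t.1).hodgeStructure (hf.isSmoothProjective t.1) (hA t.1) k).comapEquiv T).F p))
    (j : J) {a b : (Set.univ : Set (ComplexPoints S))} (γ : Path a b) (r₀ r : unitInterval)
    (x₀ x : (Set.univ : Set (ComplexPoints S))) (hx₀ : x₀ = γ r₀) (hx : x = γ r)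
    (T₀ : singularCohomology ℚ ℚ (ComplexPoints (fiberOver f s.1)) k ≃ₗ[ℚ]
      singularCohomology ℚ ℚ (ComplexPoints (fiberOver f x₀.1)) k)
    (δ₀ : Path.Homotopic.Quotient s x₀)
    (hT₀ : ∀ v, ofRatClass _ k (T₀ v) = transportFun f k hU δ₀ (ofRatClass _ k v))
    (T : singularCohomology ℚ ℚ (ComplexPoints (fiberOver f s.1)) k ≃ₗ[ℚ]
      singularCohomology ℚ ℚ (ComplexPoints (fiberOver f x.1)) k)
    (hT : ∀ v, ofRatClass _ k (T v) =
      transportFun f k hU ((Path.Homotopic.Quotient.mk (γ.subpath r₀ r)).cast hx₀ hx)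
        (ofRatClass _ k (T₀ v))) :
    finrank ℂ ↥(K j ⊓ (((A x.1).hodgeStructure (hf.isSmoothProjective x.1) (hA x.1) k).comapEquiv T).F p) =
      finrank ℂ ↥(K j ⊓
        (((A x₀.1).hodgeStructure (hf.isSmoothProjective x₀.1) (hA x₀.1) k).comapEquiv T₀).F p) := by
  classical
  subst hx₀ hx
  rw [Path.Homotopic.Quotient.cast_rfl_rfl] at hT
  -- rational transports exist along every class (smooth projective family)
  have hrat : ∀ (a' b' : (Set.univ : Set (ComplexPoints S))) (γ' : Path.Homotopic.Quotient a' b')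
      (α : complexBetti (fiberOver f a'.1) k),
      IsRationalClass α → IsRationalClass (transportFun f k hU γ' α) :=
    fun a' b' γ' α hα ↦
      isRationalClass_transportFun_of_isSmoothProjectiveFamily (f := f) (k := k) d hf hS γ' hα
  -- the states along the path: `Tr r' := T₀` continued along `γ|[r₀, r']`
  have hR : ∀ r' : unitInterval,
      ∃ R : singularCohomology ℚ ℚ (ComplexPoints (fiberOver f (γ r₀).1)) k ≃ₗ[ℚ]
          singularCohomology ℚ ℚ (ComplexPoints (fiberOver f (γ r').1)) k,
        ∀ w, ofRatClass _ k (R w) =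
          transportFun f k hU (Path.Homotopic.Quotient.mk (γ.subpath r₀ r')) (ofRatClass _ k w) :=
    fun r' ↦ exists_ratTransport f k hU hrat _
  choose R hR using hR
  let Tr : ∀ r' : unitInterval, singularCohomology ℚ ℚ (ComplexPoints (fiberOver f s.1)) k ≃ₗ[ℚ]
      singularCohomology ℚ ℚ (ComplexPoints (fiberOver f (γ r').1)) k := fun r' ↦ T₀.trans (R r')
  have hTr : ∀ r' v, ofRatClass _ k (Tr r' v) =
      transportFun f k hU (Path.Homotopic.Quotient.mk (γ.subpath r₀ r')) (ofRatClass _ k (T₀ v)) :=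
    fun r' v ↦ by
    simp only [Tr, LinearEquiv.trans_apply, hR]
  -- every `Tr r'` is admissible from `s`
  have hadm : ∀ r' v, ofRatClass _ k (Tr r' v) =
      transportFun f k hU (δ₀.trans (Path.Homotopic.Quotient.mk (γ.subpath r₀ r')))
        (ofRatClass _ k v) := fun r' v ↦ by
    rw [transportFun_trans, ← hT₀, hTr]
  -- the dimension function along the path
  let g : unitInterval → ℕ := fun r' ↦ finrank ℂ ↥(K j ⊓
    (((A (γ r').1).hodgeStructure (hf.isSmoothProjective (γ r').1) (hA (γ r').1) k).comapEquiv
      (Tr r')).F p)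
  have hlc : IsLocallyConstant g := by
    refine (IsLocallyConstant.iff_eventually_eq g).2 fun r₁ ↦ ?_
    obtain ⟨W, hWo, hr₁W, -, -, hW⟩ :=
      flatSplitting_finrank_inf_F_eq_local f n k d hf hS h𝒳 hU A hA s (γ r₁) Set.univ Filter.univ_mem
    have hV : γ ⁻¹' W ∈ 𝓝 r₁ := γ.continuous.continuousAt.preimage_mem_nhds (hWo.mem_nhds hr₁W)
    obtain ⟨ε, hε, hball⟩ := Metric.mem_nhds_iff.1 hV
    filter_upwards [Metric.ball_mem_nhds r₁ hε] with r' hr'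
    -- the sub-path from `r₁` to `r'` stays inside `W`
    have hsubW : ∀ q, γ.subpath r₁ r' q ∈ W := by
      intro q
      have hq : γ.subpath r₁ r' q ∈ γ '' Set.uIcc r₁ r' := by
        rw [← Path.range_subpath]
        exact Set.mem_range_self q
      obtain ⟨c, hc, hcq⟩ := hq
      rw [← hcq]
      apply hball
      rw [Metric.mem_ball] at hr' ⊢
      calc dist c r₁ = |(c : ℝ) - r₁| := by rw [Subtype.dist_eq, Real.dist_eq]
        _ ≤ |(r' : ℝ) - r₁| := by
            refine abs_sub_left_of_mem_uIcc ?_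
            rcases Set.mem_uIcc.1 hc with ⟨h1, h2⟩ | ⟨h1, h2⟩
            · exact Set.mem_uIcc.2 (Or.inl ⟨Subtype.coe_le_coe.2 h1, Subtype.coe_le_coe.2 h2⟩)
            · exact Set.mem_uIcc.2 (Or.inr ⟨Subtype.coe_le_coe.2 h1, Subtype.coe_le_coe.2 h2⟩)
        _ = dist r' r₁ := by rw [Subtype.dist_eq, Real.dist_eq]
        _ < ε := hr'
    have hr'W : γ r' ∈ W := hball hr'
    -- the class of `γ|[r₀, r']` is that of `γ|[r₀, r₁] · γ|[r₁, r']`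
    have hcl : Path.Homotopic.Quotient.mk (γ.subpath r₀ r') =
        (Path.Homotopic.Quotient.mk (γ.subpath r₀ r₁)).trans
          (Path.Homotopic.Quotient.mk (γ.subpath r₁ r')) :=
      (Path.Homotopic.Quotient.eq.2 ⟨(Path.Homotopy.subpathTransSubpath γ r₀ r₁ r').symm⟩).trans
        (Path.Homotopic.Quotient.mk_trans _ _)
    -- `Tr r'` is the continuation of `Tr r₁` along `γ|[r₁, r']`
    have hcont : ∀ v, ofRatClass _ k (Tr r' v) =
        transportFun f k hU (Path.Homotopic.Quotient.mk (γ.subpath r₁ r'))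
          (ofRatClass _ k (Tr r₁ v)) := fun v ↦ by
      rw [hTr, hcl, transportFun_trans, ← hTr]
    -- the local theorem at `γ r₁` with the admissible state `Tr r₁`
    refine hW (Tr r₁) ⟨δ₀.trans (Path.Homotopic.Quotient.mk (γ.subpath r₀ r₁)), hadm r₁⟩ p K ?_ j
      (γ r') hr'W (γ.subpath r₁ r') hsubW (Tr r') hcont
    -- additivity at every continuation of `Tr r₁` inside `W`: these states are admissible from `s`
    intro t _ ε' _ T' hT'
    refine hadd t ((δ₀.trans (Path.Homotopic.Quotient.mk (γ.subpath r₀ r₁))).trans ⟦ε'⟧) T'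
      fun v ↦ ?_
    rw [transportFun_trans, ← hadm]
    exact hT' v
  haveI : PreconnectedSpace unitInterval := inferInstance
  have hconst : g r = g r₀ := hlc.apply_eq_of_preconnectedSpace _ _
  -- read off: `T = Tr r` and `Tr r₀ = T₀` (`ofRatClass` is injective)
  have hTeq : T = Tr r := by
    refine LinearEquiv.ext fun v ↦ ofRatClass_injective k ?_
    rw [hT, hTr]
  have hT₀eq : Tr r₀ = T₀ := by
    refine LinearEquiv.ext fun v ↦ ofRatClass_injective k ?_
    rw [hTr, Path.subpath_self]
    exact transportFun_refl f k hU _ _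
  rw [hTeq, ← hT₀eq]
  exact hconst

/-- **GLOBAL CONSTANCY of the Hodge numbers of the pieces of a flat splitting.** In the setting of
`flatSplitting_finrank_inf_F_eq_local` (`f` smooth projective, `𝒳`, `S` quasi-projective, `S`
smooth, `Rᵏ f_* ℂ` locally trivial, Hodge models with Hodge symmetry, base point `s`): if for a
finite family of `ℂ`-subspaces `K_j ⊆ ℂ ⊗ Hᵏ(X_s; ℚ)` the additivity
`∑_j dim(K_j ∩ F^p(t,T)) = dim F^p(t,T)` holds at EVERY admissible state `(t, T)` (`T` a rational
transport from `s` along a path class `δ` from `s` to `t`; e.g. the `K_j` form a flat splitting by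
sub-variations — use `HodgeStructure.sum_finrank_inf_F_eq_of_splitting` at each state), then
`dim(K_j ∩ F^p(t,T))` equals its value `dim(K_j ∩ F^p(s, id))` at the base state, for every
admissible state: the Hodge numbers of the pieces are constant on the path component of `s` (all
of `S(ℂ)` when it is path-connected). [cite: VoisinHodgeI2002, §9.3.1 Prop. 9.20 and §10.2.1 Thm. 10.3]
[cite: Deligne1987, §1.13 (p. 10–11)] -/
theorem flatSplitting_finrank_inf_F_eq_of_ratTransport {𝒳 S : SchemeOver ℂ} (f : 𝒳 ⟶ S)
    (n k d : ℕ)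
    (hf : IsSmoothProjectiveFamily f n) (hS : IsQuasiProjectiveOver S) (h𝒳 : IsQuasiProjectiveOver 𝒳)
    [AlgebraicGeometry.SmoothOfRelativeDimension d S.hom]
    (hU : IsCohomologicallyLocallyTrivialOn f (Set.univ : Set (ComplexPoints S)))
    (A : ∀ t : ComplexPoints S, HodgeModel n (fiberOver f t)) (hA : ∀ t, (A t).IsHodgeSymmetric)
    [∀ t, Module.Finite ℚ (singularCohomology ℚ ℚ (ComplexPoints (fiberOver f t)) k)]
    (s : (Set.univ : Set (ComplexPoints S))) (p : ℤ) {J : Type} [Fintype J]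
    (K : J → Submodule ℂ (ℂ ⊗[ℚ] singularCohomology ℚ ℚ (ComplexPoints (fiberOver f s.1)) k))
    (hadd : ∀ (t : (Set.univ : Set (ComplexPoints S))) (δ : Path.Homotopic.Quotient s t)
      (T : singularCohomology ℚ ℚ (ComplexPoints (fiberOver f s.1)) k ≃ₗ[ℚ]
        singularCohomology ℚ ℚ (ComplexPoints (fiberOver f t.1)) k),
      (∀ v, ofRatClass _ k (T v) = transportFun f k hU δ (ofRatClass _ k v)) →
      ∑ j, finrank ℂ ↥(K j ⊓
          (((A t.1).hodgeStructure (hf.isSmoothProjective t.1) (hA t.1) k).comapEquiv T).F p) =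
        finrank ℂ ↥((((A t.1).hodgeStructure (hf.isSmoothProjective t.1) (hA t.1) k).comapEquiv T).F p))
    (j : J) (t : (Set.univ : Set (ComplexPoints S))) (δ : Path.Homotopic.Quotient s t)
    (T : singularCohomology ℚ ℚ (ComplexPoints (fiberOver f s.1)) k ≃ₗ[ℚ]
      singularCohomology ℚ ℚ (ComplexPoints (fiberOver f t.1)) k)
    (hT : ∀ v, ofRatClass _ k (T v) = transportFun f k hU δ (ofRatClass _ k v)) :
    finrank ℂ ↥(K j ⊓ (((A t.1).hodgeStructure (hf.isSmoothProjective t.1) (hA t.1) k).comapEquiv T).F p) =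
      finrank ℂ ↥(K j ⊓ (((A s.1).hodgeStructure (hf.isSmoothProjective s.1) (hA s.1) k).comapEquiv
        (LinearEquiv.refl ℚ _)).F p) := by
  induction δ using Path.Homotopic.Quotient.ind with
  | mk γ =>
    -- the class of `γ` is the (re-anchored) class of its sub-path `γ|[0, 1]`
    have hcl : (Path.Homotopic.Quotient.mk (γ.subpath 0 1)).cast γ.source.symm γ.target.symm =
        Path.Homotopic.Quotient.mk γ := by
      rw [Path.subpath_zero_one, Path.Homotopic.Quotient.mk_cast, Path.Homotopic.Quotient.cast_cast,
        Path.Homotopic.Quotient.cast_rfl_rfl]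
    refine flatSplitting_finrank_inf_F_eq_subpath f n k d hf hS h𝒳 hU A hA s p K hadd j γ 0 1 s t
      γ.source.symm γ.target.symm (LinearEquiv.refl ℚ _) (Path.Homotopic.Quotient.refl s)
      (fun v ↦ ?_) T (fun v ↦ ?_)
    · rw [LinearEquiv.refl_apply, transportFun_refl]
    · rw [hcl, LinearEquiv.refl_apply]
      exact hT v

/-- **Any two admissible states have the same piece-wise Hodge numbers** (symmetric form of
`flatSplitting_finrank_inf_F_eq_of_ratTransport`). [cite: VoisinHodgeI2002, §9.3.1 Prop. 9.20 and §10.2.1 Thm. 10.3]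
[cite: Deligne1987, §1.13 (p. 10–11)] -/
theorem flatSplitting_finrank_inf_F_eq_of_ratTransport₂ {𝒳 S : SchemeOver ℂ} (f : 𝒳 ⟶ S)
    (n k d : ℕ)
    (hf : IsSmoothProjectiveFamily f n) (hS : IsQuasiProjectiveOver S) (h𝒳 : IsQuasiProjectiveOver 𝒳)
    [AlgebraicGeometry.SmoothOfRelativeDimension d S.hom]
    (hU : IsCohomologicallyLocallyTrivialOn f (Set.univ : Set (ComplexPoints S)))
    (A : ∀ t : ComplexPoints S, HodgeModel n (fiberOver f t)) (hA : ∀ t, (A t).IsHodgeSymmetric)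
    [∀ t, Module.Finite ℚ (singularCohomology ℚ ℚ (ComplexPoints (fiberOver f t)) k)]
    (s : (Set.univ : Set (ComplexPoints S))) (p : ℤ) {J : Type} [Fintype J]
    (K : J → Submodule ℂ (ℂ ⊗[ℚ] singularCohomology ℚ ℚ (ComplexPoints (fiberOver f s.1)) k))
    (hadd : ∀ (t : (Set.univ : Set (ComplexPoints S))) (δ : Path.Homotopic.Quotient s t)
      (T : singularCohomology ℚ ℚ (ComplexPoints (fiberOver f s.1)) k ≃ₗ[ℚ]
        singularCohomology ℚ ℚ (ComplexPoints (fiberOver f t.1)) k),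
      (∀ v, ofRatClass _ k (T v) = transportFun f k hU δ (ofRatClass _ k v)) →
      ∑ j, finrank ℂ ↥(K j ⊓
          (((A t.1).hodgeStructure (hf.isSmoothProjective t.1) (hA t.1) k).comapEquiv T).F p) =
        finrank ℂ ↥((((A t.1).hodgeStructure (hf.isSmoothProjective t.1) (hA t.1) k).comapEquiv T).F p))
    (j : J) (t t' : (Set.univ : Set (ComplexPoints S))) (δ : Path.Homotopic.Quotient s t)
    (δ' : Path.Homotopic.Quotient s t')
    (T : singularCohomology ℚ ℚ (ComplexPoints (fiberOver f s.1)) k ≃ₗ[ℚ]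
      singularCohomology ℚ ℚ (ComplexPoints (fiberOver f t.1)) k)
    (T' : singularCohomology ℚ ℚ (ComplexPoints (fiberOver f s.1)) k ≃ₗ[ℚ]
      singularCohomology ℚ ℚ (ComplexPoints (fiberOver f t'.1)) k)
    (hT : ∀ v, ofRatClass _ k (T v) = transportFun f k hU δ (ofRatClass _ k v))
    (hT' : ∀ v, ofRatClass _ k (T' v) = transportFun f k hU δ' (ofRatClass _ k v)) :
    finrank ℂ ↥(K j ⊓ (((A t.1).hodgeStructure (hf.isSmoothProjective t.1) (hA t.1) k).comapEquiv T).F p) =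
      finrank ℂ ↥(K j ⊓
        (((A t'.1).hodgeStructure (hf.isSmoothProjective t'.1) (hA t'.1) k).comapEquiv T').F p) := by
  rw [flatSplitting_finrank_inf_F_eq_of_ratTransport f n k d hf hS h𝒳 hU A hA s p K hadd j t δ T hT,
    flatSplitting_finrank_inf_F_eq_of_ratTransport f n k d hf hS h𝒳 hU A hA s p K hadd j t' δ' T' hT']

/-- **Admissible states exist at every point of an irreducible base.** For `f : 𝒳 → S` smooth
projective with `S` quasi-projective, smooth of dimension `d` and IRREDUCIBLE, `S(ℂ)` is path
connected (connected by SGA1 XII Prop. 2.4 — the tree's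
`ComplexPoints.isConnected_setOf_pt_mem_of_isIrreducible_holds` — and locally path connected as a
topological `2d`-manifold, `ComplexPoints.chartedSpace`), so every `t ∈ S(ℂ)` is joined to the base
point `s` by a path class `δ`, along which a rational transport `T` exists
(`exists_ratTransport`, rational classes being preserved for smooth projective families).
[cite: SGA1, Exp. XII Prop. 2.4 (cas irréductible)] [cite: VoisinHodgeII2003, §3.1.2] -/
theorem exists_ratTransport_of_irreducibleSpace {𝒳 S : SchemeOver ℂ} (f : 𝒳 ⟶ S) (n k d : ℕ)
    (hf : IsSmoothProjectiveFamily f n) (hS : IsQuasiProjectiveOver S)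
    [AlgebraicGeometry.SmoothOfRelativeDimension d S.hom] [IrreducibleSpace S.left]
    (hU : IsCohomologicallyLocallyTrivialOn f (Set.univ : Set (ComplexPoints S)))
    (s t : (Set.univ : Set (ComplexPoints S))) :
    ∃ (δ : Path.Homotopic.Quotient s t)
      (T : singularCohomology ℚ ℚ (ComplexPoints (fiberOver f s.1)) k ≃ₗ[ℚ]
        singularCohomology ℚ ℚ (ComplexPoints (fiberOver f t.1)) k),
      ∀ v, ofRatClass _ k (T v) = transportFun f k hU δ (ofRatClass _ k v) := by
  haveI : LocallyOfFiniteType S.hom := hS.locallyOfFiniteType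
  -- `S(ℂ)` is connected (irreducible base) ...
  have hconn : IsConnected {P : ComplexPoints S | P.pt ∈ (Set.univ : Set S.left)} :=
    Motives.ComplexPoints.isConnected_setOf_pt_mem_of_isIrreducible_holds S isClosed_univ
      (IrreducibleSpace.isIrreducible_univ (X := ↥S.left))
  have huniv : IsConnected (Set.univ : Set (ComplexPoints S)) := by
    convert hconn using 1
    ext P
    simp
  haveI : ConnectedSpace (ComplexPoints S) := connectedSpace_iff_univ.2 huniv
  -- ... and locally path connected (a topological manifold), hence path connected
  letI := Motives.ComplexPoints.chartedSpace S d
  haveI : LocallyPathConnectedSpace (ComplexPoints S) :=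
    ChartedSpace.locallyPathConnectedSpace (EuclideanSpace ℝ (Fin (2 * d))) _
  haveI : PathConnectedSpace (ComplexPoints S) := pathConnectedSpace_iff_connectedSpace.2 inferInstance
  haveI : PathConnectedSpace (Set.univ : Set (ComplexPoints S)) :=
    isPathConnected_iff_pathConnectedSpace.1 (pathConnectedSpace_iff_univ.1 inferInstance)
  have hrat : ∀ (a' b' : (Set.univ : Set (ComplexPoints S))) (γ' : Path.Homotopic.Quotient a' b')
      (α : complexBetti (fiberOver f a'.1) k),
      IsRationalClass α → IsRationalClass (transportFun f k hU γ' α) :=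
    fun a' b' γ' α hα ↦
      isRationalClass_transportFun_of_isSmoothProjectiveFamily (f := f) (k := k) d hf hS γ' hα
  obtain ⟨T, hT⟩ := exists_ratTransport f k hU hrat
    (⟦PathConnectedSpace.somePath s t⟧ : Path.Homotopic.Quotient s t)
  exact ⟨_, T, hT⟩

/-- **Over an IRREDUCIBLE base the piece-wise Hodge numbers are the same at every member**:
`flatSplitting_finrank_inf_F_eq_of_ratTransport` together with the existence of admissible states
at every `t ∈ S(ℂ)` (`exists_ratTransport_of_irreducibleSpace`). For each `t` there is an
admissible state `(δ, T)` — and at every admissible state the dimensions `dim(K_j ∩ F^p(t,T))`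
equal their values at the base state `(s, id)`. (For INTRINSIC pieces — `K_j` the base-point value
of a flat family of subspaces `K_j(t) ⊆ ℂ ⊗ Hᵏ(X_t; ℚ)`, e.g. the eigenspaces of a flat
automorphism — `K_j ∩ F^p(t,T) = T⁻¹(K_j(t) ∩ F^p(X_t))`, so this is «`dim(K_j(t) ∩ F^p(X_t))` is
independent of `t`».) [cite: VoisinHodgeI2002, §9.3.1 Prop. 9.20 and §10.2.1 Thm. 10.3]
[cite: Deligne1987, §1.13 (p. 10–11)] -/
theorem flatSplitting_finrank_inf_F_eq_forall_of_irreducibleSpace {𝒳 S : SchemeOver ℂ}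
    (f : 𝒳 ⟶ S) (n k d : ℕ)
    (hf : IsSmoothProjectiveFamily f n) (hS : IsQuasiProjectiveOver S) (h𝒳 : IsQuasiProjectiveOver 𝒳)
    [AlgebraicGeometry.SmoothOfRelativeDimension d S.hom] [IrreducibleSpace S.left]
    (hU : IsCohomologicallyLocallyTrivialOn f (Set.univ : Set (ComplexPoints S)))
    (A : ∀ t : ComplexPoints S, HodgeModel n (fiberOver f t)) (hA : ∀ t, (A t).IsHodgeSymmetric)
    [∀ t, Module.Finite ℚ (singularCohomology ℚ ℚ (ComplexPoints (fiberOver f t)) k)]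
    (s : (Set.univ : Set (ComplexPoints S))) (p : ℤ) {J : Type} [Fintype J]
    (K : J → Submodule ℂ (ℂ ⊗[ℚ] singularCohomology ℚ ℚ (ComplexPoints (fiberOver f s.1)) k))
    (hadd : ∀ (t : (Set.univ : Set (ComplexPoints S))) (δ : Path.Homotopic.Quotient s t)
      (T : singularCohomology ℚ ℚ (ComplexPoints (fiberOver f s.1)) k ≃ₗ[ℚ]
        singularCohomology ℚ ℚ (ComplexPoints (fiberOver f t.1)) k),
      (∀ v, ofRatClass _ k (T v) = transportFun f k hU δ (ofRatClass _ k v)) →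
      ∑ j, finrank ℂ ↥(K j ⊓
          (((A t.1).hodgeStructure (hf.isSmoothProjective t.1) (hA t.1) k).comapEquiv T).F p) =
        finrank ℂ ↥((((A t.1).hodgeStructure (hf.isSmoothProjective t.1) (hA t.1) k).comapEquiv T).F p))
    (t : (Set.univ : Set (ComplexPoints S))) :
    ∃ (δ : Path.Homotopic.Quotient s t)
      (T : singularCohomology ℚ ℚ (ComplexPoints (fiberOver f s.1)) k ≃ₗ[ℚ]
        singularCohomology ℚ ℚ (ComplexPoints (fiberOver f t.1)) k),
      (∀ v, ofRatClass _ k (T v) = transportFun f k hU δ (ofRatClass _ k v)) ∧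
      ∀ j, finrank ℂ ↥(K j ⊓
          (((A t.1).hodgeStructure (hf.isSmoothProjective t.1) (hA t.1) k).comapEquiv T).F p) =
        finrank ℂ ↥(K j ⊓ (((A s.1).hodgeStructure (hf.isSmoothProjective s.1) (hA s.1) k).comapEquiv
          (LinearEquiv.refl ℚ _)).F p) := by
  obtain ⟨δ, T, hT⟩ := exists_ratTransport_of_irreducibleSpace f n k d hf hS hU s t
  exact ⟨δ, T, hT, fun j ↦
    flatSplitting_finrank_inf_F_eq_of_ratTransport f n k d hf hS h𝒳 hU A hA s p K hadd j t δ T hT⟩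

end Global

end HodgeTheory

end Literature.AlgebraicGeometry.HodgeTheory

end
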